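import Summits.CriticalPhenomena.PercolationContinuityZ3.Theorems.PercNearOneGluingNoHeavyLowerTailStarSetRows
import Summits.CriticalPhenomena.PercolationContinuityZ3.Theorems.PercNearOneGluingNoHeavyLowerTailStarSetNestedCertificateCore
import Literature.Probability.Percolation.LonePortSum
import HarnessLib

/-!
# `NoHeavyLowerTail` (stmt-CriticalPhenomena-4575) — the ALL-COMONOTONE word of a two-port star family at level `j ≤ 2`

Support file (prover `prim-gen-swap` gen 7; `--supports stmt-CriticalPhenomena-4575`).  No definitions, no named facts, no sorries.

Setting as in `…StarSetRows` / `…StarSetGateExpansion`: stars `s i` off `A` with ports `p i ≠ p' i ∈ A`, all ports pairwise distinct, port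
weights `β_i, β_i'`, `θ_i = β_iβ_i'`, pattern weights `w(σ) = Π_{i∈σ}θ_iΠ_{i∉σ}(1−θ_i)`, `ξ(ω)` the configuration off the stars, `L_σ` the
links of `σ`, `P_σ = {p i, p' i : i ∈ σ}` the port set of the comonotone word in pattern `σ`; `c ∈ A` not a port dominating the first ports.

Pointwise facts at level `j ≤ 2` (seat memo R3-SEATS.md §5):
* `StarSet.mem_portPattern_iff` — `u ∈ P_σ` iff `u` is an endpoint of a link of `L_σ`;
* `StarSet.portPattern_lonely_singleton` — (ii) `1 ≤ |π_ξ(P_σ)| ≤ 2` forces `σ = {i}`;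
* `StarSet.lonely_port_light` — (iii) if `|π_ξ({p i, p' i})| ≤ j ≤ 2` then `|π_{ξ∪L_τ}(p i)| ≤ j` for EVERY pattern `τ`;
  ((i), `(c ↮_ξ P_σ ∧ |π_ξ(c)| ≤ j) ↔ |π_{ξ∪L_σ}(c)| ≤ j`, is `StarSet.sepSmall_links_iff` with `R = ∅`.)
Integration:
* `StarSet.linkSum_real_sub_eq_sum` — a pattern sum of differences of probabilities as a finite weighted sum over configurations;
* `StarSet.comonotone_word_nonneg` — **`0 ≤ Σ_σ w(σ)·[μ_w(c ↮_ξ P_σ, |π_ξ(c)| ≤ j) − μ_w(c ↮_ξ P_σ, 1 ≤ |π_ξ(P_σ)| ≤ j)]`**: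
  pointwise the nested certificate `StarSet.nestedCertificate_core` bounds the bracket sum below by `Σ_i c_i Σ_σ w(σ)([|π_{ξ∪L_σ}(c)| ≤ j]
  − [|π_{ξ∪L_σ}(p i)| ≤ j])`, whose expectation is `Σ_i c_i (I_w(c) − I_w(p i)) ≥ 0` (`StarSet.lightness_eq_linkSum`).  This is step (4) of
  the level-two observer-set theorem for two-port star sets (R3-SEATS.md §7).
-/

noncomputable section

namespace Summit.CriticalPhenomena.PercolationContinuityZ3.Theorems

open MeasureTheory Set Literature.Probability.LatticeModels Literature.Probability.Percolation
open scoped Classical BigOperators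

variable {n m : ℕ}

namespace StarSet

/-- `u ∈ P_σ` iff `u` is an endpoint of a link of the pattern `σ`. [folklore] -/
theorem mem_portPattern_iff (p p' : Fin m → Fin n) (σ : Finset (Fin m)) (u : Fin n) :
    u ∈ σ.image p ∪ σ.image p' ↔ ∃ l ∈ σ.image (fun i => (s(p i, p' i) : Sym2 (Fin n))), u ∈ l := by
  simp only [Finset.mem_union, Finset.mem_image]
  constructor
  · rintro (⟨i, hi, rfl⟩ | ⟨i, hi, rfl⟩)
    · exact ⟨s(p i, p' i), ⟨i, hi, rfl⟩, Sym2.mem_mk_left _ _⟩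
    · exact ⟨s(p i, p' i), ⟨i, hi, rfl⟩, Sym2.mem_mk_right _ _⟩
  · rintro ⟨l, ⟨i, hi, rfl⟩, hu⟩
    rcases Sym2.mem_iff.1 hu with rfl | rfl
    · exact Or.inl ⟨i, hi, rfl⟩
    · exact Or.inr ⟨i, hi, rfl⟩

/-- **(ii) Only single-star patterns are lonely at level two.**  If the relays joined to `P_σ` number between `1` and `j ≤ 2` (distinct
ports in `A`), then `σ` is a singleton. [folklore] -/
theorem portPattern_lonely_singleton (ω : BondConfig (Fin n)) (A : Finset (Fin n)) (p p' : Fin m → Fin n) (σ : Finset (Fin m))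
    (j : ℕ) (hj : j ≤ 2) (hpA : ∀ i, p i ∈ A) (hp'A : ∀ i, p' i ∈ A) (hpp' : ∀ i, p i ≠ p' i)
    (hdis : ∀ i k, i ≠ k → p i ≠ p k ∧ p i ≠ p' k ∧ p' i ≠ p' k)
    (h1 : 1 ≤ (A.filter fun z => ∃ u ∈ σ.image p ∪ σ.image p', (openGraph ω).Reachable u z).card)
    (h2 : (A.filter fun z => ∃ u ∈ σ.image p ∪ σ.image p', (openGraph ω).Reachable u z).card ≤ j) :
    ∃ i, σ = {i} := by
  obtain ⟨z, hz⟩ := Finset.card_pos.1 h1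
  obtain ⟨-, u, hu, -⟩ := Finset.mem_filter.1 hz
  have hσ : σ.Nonempty := by
    rcases Finset.mem_union.1 hu with hu | hu <;>
    · obtain ⟨i, hi, -⟩ := Finset.mem_image.1 hu; exact ⟨i, hi⟩
  obtain ⟨i, hi⟩ := hσ
  refine ⟨i, Finset.eq_singleton_iff_unique_mem.2 ⟨hi, fun k hk => ?_⟩⟩
  by_contra hki
  have hmem : ∀ x, (∃ l ∈ σ, x = p l ∨ x = p' l) → x ∈ A →
      x ∈ A.filter fun z => ∃ u ∈ σ.image p ∪ σ.image p', (openGraph ω).Reachable u z := by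
    rintro x ⟨l, hl, hx⟩ hxA
    refine Finset.mem_filter.2 ⟨hxA, x, ?_, SimpleGraph.Reachable.refl x⟩
    rcases hx with rfl | rfl
    · exact Finset.mem_union_left _ (Finset.mem_image_of_mem p hl)
    · exact Finset.mem_union_right _ (Finset.mem_image_of_mem p' hl)
  have hsub : ({p i, p' i, p k, p' k} : Finset (Fin n)) ⊆
      A.filter fun z => ∃ u ∈ σ.image p ∪ σ.image p', (openGraph ω).Reachable u z := by
    intro x hx
    simp only [Finset.mem_insert, Finset.mem_singleton] at hx
    rcases hx with rfl | rfl | rfl | rfl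
    · exact hmem _ ⟨i, hi, Or.inl rfl⟩ (hpA i)
    · exact hmem _ ⟨i, hi, Or.inr rfl⟩ (hp'A i)
    · exact hmem _ ⟨k, hk, Or.inl rfl⟩ (hpA k)
    · exact hmem _ ⟨k, hk, Or.inr rfl⟩ (hp'A k)
  have hd := hdis k i hki
  have hd' := hdis i k (Ne.symm hki)
  have hcard : ({p i, p' i, p k, p' k} : Finset (Fin n)).card = 4 := by
    rw [Finset.card_insert_of_notMem, Finset.card_insert_of_notMem, Finset.card_pair (hpp' k)]
    · simp only [Finset.mem_insert, Finset.mem_singleton, not_or]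
      exact ⟨fun h => hd.2.1 h.symm, hd'.2.2⟩
    · simp only [Finset.mem_insert, Finset.mem_singleton, not_or]
      exact ⟨hpp' i, hd'.1, hd'.2.1⟩
  have := Finset.card_le_card hsub
  omega

/-- **(iii) A lonely pair of ports stays light under every link pattern.**  If the relays joined in `ω` to `p i` or `p' i` number at most
`j ≤ 2` (distinct ports in `A`), then for every pattern `τ` the relays joined to `p i` in `ω ∪ L_τ` number at most `j`. [folklore] -/
theorem lonely_port_light (ω : BondConfig (Fin n)) (A : Finset (Fin n)) (p p' : Fin m → Fin n) (i : Fin m) (τ : Finset (Fin m))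
    (j : ℕ) (hj : j ≤ 2) (hpA : ∀ i, p i ∈ A) (hp'A : ∀ i, p' i ∈ A) (hpp' : ∀ i, p i ≠ p' i)
    (hdis : ∀ i k, i ≠ k → p i ≠ p k ∧ p i ≠ p' k ∧ p' i ≠ p' k)
    (h : (A.filter fun z => ∃ u ∈ ({i} : Finset (Fin m)).image p ∪ ({i} : Finset (Fin m)).image p',
      (openGraph ω).Reachable u z).card ≤ j) :
    (A.filter fun z => (openGraph (ω ∪ ↑(τ.image fun k => (s(p k, p' k) : Sym2 (Fin n))))).Reachable (p i) z).card ≤ j := by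
  set Q := A.filter fun z => ∃ u ∈ ({i} : Finset (Fin m)).image p ∪ ({i} : Finset (Fin m)).image p',
    (openGraph ω).Reachable u z with hQ
  have hmemQ : ∀ z, z ∈ Q ↔ z ∈ A ∧ ((openGraph ω).Reachable (p i) z ∨ (openGraph ω).Reachable (p' i) z) := by
    intro z
    rw [hQ, Finset.mem_filter]
    simp only [Finset.image_singleton, Finset.mem_union, Finset.mem_singleton]
    constructor
    · rintro ⟨hzA, u, hu, huz⟩
      rcases hu with rfl | rfl
      · exact ⟨hzA, Or.inl huz⟩
      · exact ⟨hzA, Or.inr huz⟩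
    · rintro ⟨hzA, h | h⟩
      · exact ⟨hzA, p i, Or.inl rfl, h⟩
      · exact ⟨hzA, p' i, Or.inr rfl, h⟩
  have hsubQ : ({p i, p' i} : Finset (Fin n)) ⊆ Q := by
    intro x hx
    simp only [Finset.mem_insert, Finset.mem_singleton] at hx
    rcases hx with rfl | rfl
    · exact (hmemQ _).2 ⟨hpA i, Or.inl (SimpleGraph.Reachable.refl _)⟩
    · exact (hmemQ _).2 ⟨hp'A i, Or.inr (SimpleGraph.Reachable.refl _)⟩
  have hQeq : ({p i, p' i} : Finset (Fin n)) = Q := by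
    refine Finset.eq_of_subset_of_card_le hsubQ ?_
    rw [Finset.card_pair (hpp' i)]
    omega
  -- every vertex joined to `p i` through the links is joined in `ω` to `p i` or to `p' i`
  have hcl : ∀ z, (openGraph (ω ∪ ↑(τ.image fun k => (s(p k, p' k) : Sym2 (Fin n))))).Reachable (p i) z →
      (openGraph ω).Reachable (p i) z ∨ (openGraph ω).Reachable (p' i) z := by
    intro z hz
    refine reachable_of_adjClosed _ {v | (openGraph ω).Reachable (p i) v ∨ (openGraph ω).Reachable (p' i) v}
      (x := p i) (Or.inl (SimpleGraph.Reachable.refl _)) ?_ hz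
    intro u v hu huv
    rw [openGraph_adj, mem_union] at huv
    obtain ⟨huv, hne⟩ := huv
    rcases huv with hω | hL
    · have hadj : (openGraph ω).Adj u v := by rw [openGraph_adj]; exact ⟨hω, hne⟩
      rcases hu with hu | hu
      · exact Or.inl (hu.trans hadj.reachable)
      · exact Or.inr (hu.trans hadj.reachable)
    · rw [Finset.mem_coe, Finset.mem_image] at hL
      obtain ⟨k, -, hk⟩ := hL
      -- `u` is a port of star `k` joined to `p i` or `p' i`; hence `u ∈ Q = {p i, p' i}` and `k = i`
      have huport : u = p k ∨ u = p' k := by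
        rcases Sym2.eq_iff.1 hk with ⟨h1, _⟩ | ⟨_, h1⟩
        · exact Or.inl h1.symm
        · exact Or.inr h1.symm
      have huA : u ∈ A := by rcases huport with rfl | rfl; exacts [hpA k, hp'A k]
      have huQ : u ∈ Q := (hmemQ u).2 ⟨huA, hu⟩
      rw [← hQeq] at huQ
      simp only [Finset.mem_insert, Finset.mem_singleton] at huQ
      have hki : k = i := by
        by_contra hki
        have hd := hdis k i hki
        have hd' := hdis i k (Ne.symm hki)
        rcases huport with rfl | rfl <;> rcases huQ with h' | h'
        · exact hd.1 h'
        · exact hd.2.1 h'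
        · exact hd'.2.1 h'.symm
        · exact hd.2.2 h'
      subst hki
      -- `v` is the other endpoint, i.e. `p k` or `p' k`
      have hvport : v = p k ∨ v = p' k := by
        rcases Sym2.eq_iff.1 hk with ⟨_, h2⟩ | ⟨h2, _⟩
        · exact Or.inr h2.symm
        · exact Or.inl h2.symm
      rcases hvport with rfl | rfl
      · exact Or.inl (SimpleGraph.Reachable.refl _)
      · exact Or.inr (SimpleGraph.Reachable.refl _)
  calc (A.filter fun z => (openGraph (ω ∪ ↑(τ.image fun k => (s(p k, p' k) : Sym2 (Fin n))))).Reachable (p i) z).card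
      ≤ Q.card := Finset.card_le_card fun z hz => by
        rw [Finset.mem_filter] at hz
        exact (hmemQ z).2 ⟨hz.1, hcl z hz.2⟩
    _ ≤ j := h

/-- A pattern sum of differences of probabilities, as a finite weighted sum over the configurations. [folklore] -/
theorem linkSum_real_sub_eq_sum (w : Sym2 (Fin n) → unitInterval) (W : Finset (Fin m) → ℝ)
    (D₁ D₂ : Finset (Fin m) → Set (BondConfig (Fin n))) :
    ∑ σ ∈ (Finset.univ : Finset (Fin m)).powerset, W σ * ((prodBernoulli w).real (D₁ σ) - (prodBernoulli w).real (D₂ σ)) =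
      ∑ ω : BondConfig (Fin n), BHK2006.weight (fun e => (w e : ℝ)) ω *
        ∑ σ ∈ (Finset.univ : Finset (Fin m)).powerset, W σ * (DecisionTree.ind (D₁ σ) ω - DecisionTree.ind (D₂ σ) ω) := by
  calc ∑ σ ∈ (Finset.univ : Finset (Fin m)).powerset, W σ * ((prodBernoulli w).real (D₁ σ) - (prodBernoulli w).real (D₂ σ))
      = ∑ σ ∈ (Finset.univ : Finset (Fin m)).powerset, ∑ ω : BondConfig (Fin n),
          W σ * (BHK2006.weight (fun e => (w e : ℝ)) ω * DecisionTree.ind (D₁ σ) ω -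
            BHK2006.weight (fun e => (w e : ℝ)) ω * DecisionTree.ind (D₂ σ) ω) := by
        refine Finset.sum_congr rfl fun σ _ => ?_
        rw [LonePortSum.measureReal_eq_sum, LonePortSum.measureReal_eq_sum, ← Finset.sum_sub_distrib, Finset.mul_sum]
    _ = ∑ ω : BondConfig (Fin n), ∑ σ ∈ (Finset.univ : Finset (Fin m)).powerset,
          W σ * (BHK2006.weight (fun e => (w e : ℝ)) ω * DecisionTree.ind (D₁ σ) ω -
            BHK2006.weight (fun e => (w e : ℝ)) ω * DecisionTree.ind (D₂ σ) ω) := Finset.sum_comm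
    _ = _ := by
        refine Finset.sum_congr rfl fun ω _ => ?_
        rw [Finset.mul_sum]
        refine Finset.sum_congr rfl fun σ _ => ?_
        ring

/-- **The comonotone word is nonnegative (level `j ≤ 2`).**  See the file header. [cite: VandenbergHaggstromKahn2005, Thm. 1.5 (p. 7) —
only through the hypothesis that `c` dominates the ports; the step itself is elementary] -/
theorem comonotone_word_nonneg (w : Sym2 (Fin n) → unitInterval) (A : Finset (Fin n)) (s p p' : Fin m → Fin n) (c : Fin n)
    (j : ℕ) (hj : j ≤ 2) (hs : Function.Injective s) (hsA : ∀ i, s i ∉ A) (hpA : ∀ i, p i ∈ A) (hp'A : ∀ i, p' i ∈ A)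
    (hpp' : ∀ i, p i ≠ p' i) (hdis : ∀ i k, i ≠ k → p i ≠ p k ∧ p i ≠ p' k ∧ p' i ≠ p' k) (hcA : c ∈ A)
    (hcp : ∀ i, c ≠ p i ∧ c ≠ p' i) (hwjunk : ∀ i u, u ≠ s i → u ≠ p i → u ≠ p' i → w s(s i, u) = 0)
    (hdom : ∀ i, (prodBernoulli w).real {ω : BondConfig (Fin n) | (A.filter fun z => ω ∈ openConn (p i) z).card ≤ j} ≤
      (prodBernoulli w).real {ω : BondConfig (Fin n) | (A.filter fun z => ω ∈ openConn c z).card ≤ j}) :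
    0 ≤ ∑ σ ∈ (Finset.univ : Finset (Fin m)).powerset,
      ((∏ i ∈ σ, ((w s(s i, p i) : ℝ) * w s(s i, p' i))) * ∏ i ∈ Finset.univ \ σ, (1 - (w s(s i, p i) : ℝ) * w s(s i, p' i))) *
        ((prodBernoulli w).real {ω : BondConfig (Fin n) |
            (∀ u ∈ σ.image p ∪ σ.image p', ¬ (openGraph (ω ∩ {e | ∀ v ∈ Finset.univ.image s, v ∉ e})).Reachable c u) ∧
            (A.filter fun z => (openGraph (ω ∩ {e | ∀ v ∈ Finset.univ.image s, v ∉ e})).Reachable c z).card ≤ j} -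
          (prodBernoulli w).real {ω : BondConfig (Fin n) |
            (∀ u ∈ σ.image p ∪ σ.image p', ¬ (openGraph (ω ∩ {e | ∀ v ∈ Finset.univ.image s, v ∉ e})).Reachable c u) ∧
            1 ≤ (A.filter fun z => ∃ u ∈ σ.image p ∪ σ.image p',
              (openGraph (ω ∩ {e | ∀ v ∈ Finset.univ.image s, v ∉ e})).Reachable u z).card ∧
            (A.filter fun z => ∃ u ∈ σ.image p ∪ σ.image p',
              (openGraph (ω ∩ {e | ∀ v ∈ Finset.univ.image s, v ∉ e})).Reachable u z).card ≤ j}) := by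
  have hps : ∀ i k, p i ≠ s k := fun i k h => hsA k (h ▸ hpA i)
  have hp's : ∀ i k, p' i ≠ s k := fun i k h => hsA k (h ▸ hp'A i)
  have hcs : ∀ i, c ≠ s i := fun i h => hsA i (h ▸ hcA)
  -- abbreviations: pattern weights and nested coefficients
  set θ : Fin m → ℝ := fun i => (w s(s i, p i) : ℝ) * w s(s i, p' i) with hθ
  have hθ0 : ∀ i, 0 ≤ θ i := fun i => mul_nonneg (w _).2.1 (w _).2.1
  have hθ1 : ∀ i, θ i ≤ 1 := fun i => mul_le_one₀ (w _).2.2 (w _).2.1 (w _).2.2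
  set W : Finset (Fin m) → ℝ := fun σ => (∏ i ∈ σ, θ i) * ∏ i ∈ Finset.univ \ σ, (1 - θ i) with hW
  set cf : Fin m → ℝ := fun i => θ i * ∏ k ∈ Finset.univ.filter (· < i), (1 - θ k) with hcf
  have hcf0 : ∀ i, 0 ≤ cf i := fun i => mul_nonneg (hθ0 i) (Finset.prod_nonneg fun k _ => sub_nonneg.2 (hθ1 k))
  -- the events: honest cells `D₁ ⊇?` (ρ) and `D₂` (ℓ), link-lightness `G` of `c` and `Sp i` of `p i`
  set ξ : BondConfig (Fin n) → BondConfig (Fin n) := fun ω => ω ∩ {e | ∀ v ∈ Finset.univ.image s, v ∉ e} with hξ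
  set D₁ : Finset (Fin m) → Set (BondConfig (Fin n)) := fun σ => {ω |
    (∀ u ∈ σ.image p ∪ σ.image p', ¬ (openGraph (ξ ω)).Reachable c u) ∧
      (A.filter fun z => (openGraph (ξ ω)).Reachable c z).card ≤ j} with hD₁
  set D₂ : Finset (Fin m) → Set (BondConfig (Fin n)) := fun σ => {ω |
    (∀ u ∈ σ.image p ∪ σ.image p', ¬ (openGraph (ξ ω)).Reachable c u) ∧
      1 ≤ (A.filter fun z => ∃ u ∈ σ.image p ∪ σ.image p', (openGraph (ξ ω)).Reachable u z).card ∧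
      (A.filter fun z => ∃ u ∈ σ.image p ∪ σ.image p', (openGraph (ξ ω)).Reachable u z).card ≤ j} with hD₂
  set G : Finset (Fin m) → Set (BondConfig (Fin n)) := fun σ => {ω |
    (A.filter fun z => (openGraph (ξ ω ∪ ↑(σ.image fun i => (s(p i, p' i) : Sym2 (Fin n))))).Reachable c z).card ≤ j}
    with hG
  set Sp : Fin m → Finset (Fin m) → Set (BondConfig (Fin n)) := fun i σ => {ω |
    (A.filter fun z => (openGraph (ξ ω ∪ ↑(σ.image fun i => (s(p i, p' i) : Sym2 (Fin n))))).Reachable (p i) z).card ≤ j}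
    with hSp
  -- (1) pointwise certificate
  have hpt : ∀ ω : BondConfig (Fin n),
      ∑ i, cf i * ∑ σ ∈ (Finset.univ : Finset (Fin m)).powerset, W σ * (DecisionTree.ind (G σ) ω - DecisionTree.ind (Sp i σ) ω) ≤
        ∑ σ ∈ (Finset.univ : Finset (Fin m)).powerset, W σ * (DecisionTree.ind (D₁ σ) ω - DecisionTree.ind (D₂ σ) ω) := by
    intro ω
    -- (i) the ρ-cell is the link-lightness of `c`
    have hi : ∀ σ, DecisionTree.ind (D₁ σ) ω = DecisionTree.ind (G σ) ω := by
      intro σ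
      have hΛ : ∀ l ∈ σ.image (fun i => (s(p i, p' i) : Sym2 (Fin n))),
          ∃ q q', l = s(q, q') ∧ q ≠ q' ∧ q ∈ A ∧ q' ∈ A ∧ q ≠ c ∧ q' ≠ c := by
        intro l hl
        obtain ⟨i, -, rfl⟩ := Finset.mem_image.1 hl
        exact ⟨p i, p' i, rfl, hpp' i, hpA i, hp'A i, (hcp i).1.symm, (hcp i).2.symm⟩
      have key := sepSmall_links_iff (ξ ω) (σ.image fun i => (s(p i, p' i) : Sym2 (Fin n))) A ∅ c j hj hcA hΛ
      have hiff : ω ∈ D₁ σ ↔ ω ∈ G σ := by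
        simp only [hD₁, hG, mem_setOf_eq]
        constructor
        · rintro ⟨hsep, hsmall⟩
          have h3 := key.1 ⟨fun y hy => absurd hy (Finset.notMem_empty y),
            fun l hl v hv => hsep v ((mem_portPattern_iff p p' σ v).2 ⟨l, hl, hv⟩), by convert hsmall using 4⟩
          convert h3.2 using 4
        · intro hsmall
          have h3 := key.2 ⟨fun y hy => absurd hy (Finset.notMem_empty y), by convert hsmall using 4⟩
          refine ⟨fun u hu => ?_, by convert h3.2.2 using 4⟩
          obtain ⟨l, hl, hul⟩ := (mem_portPattern_iff p p' σ u).1 hu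
          exact h3.2.1 l hl u hul
      by_cases hω : ω ∈ D₁ σ
      · rw [DecisionTree.ind_of_mem hω, DecisionTree.ind_of_mem (hiff.1 hω)]
      · rw [DecisionTree.ind_of_not_mem hω, DecisionTree.ind_of_not_mem (fun h => hω (hiff.2 h))]
    have hrhs : ∑ σ ∈ (Finset.univ : Finset (Fin m)).powerset, W σ * (DecisionTree.ind (D₁ σ) ω - DecisionTree.ind (D₂ σ) ω) =
        ∑ σ ∈ (Finset.univ : Finset (Fin m)).powerset, W σ * (DecisionTree.ind (G σ) ω - DecisionTree.ind (D₂ σ) ω) := by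
      refine Finset.sum_congr rfl fun σ _ => ?_
      rw [hi σ]
    rw [hrhs]
    refine nestedCertificate_core θ hθ0 hθ1 (fun σ => DecisionTree.ind (G σ) ω) (fun σ => DecisionTree.ind (D₂ σ) ω)
      (fun i σ => DecisionTree.ind (Sp i σ) ω) (fun σ => DecisionTree.ind_nonneg _ _) ?_ (fun i => DecisionTree.ind_nonneg _ _) ?_
    · -- (ii) only singletons are lonely
      intro σ hσ
      refine DecisionTree.ind_of_not_mem fun hω => ?_
      simp only [hD₂, mem_setOf_eq] at hω
      obtain ⟨i, rfl⟩ := portPattern_lonely_singleton (ξ ω) A p p' σ j hj hpA hp'A hpp' hdis hω.2.1 hω.2.2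
      exact hσ i rfl
    · -- (iii) a lonely star has a light designated port in every pattern
      intro i σ
      by_cases hω : ω ∈ D₂ {i}
      · simp only [hD₂, mem_setOf_eq] at hω
        have hsp : ω ∈ Sp i σ := by
          simp only [hSp, mem_setOf_eq]
          exact lonely_port_light (ξ ω) A p p' i σ j hj hpA hp'A hpp' hdis hω.2.2
        rw [DecisionTree.ind_of_mem hsp]
        exact BHK2006.ind_le_one _ _
      · rw [DecisionTree.ind_of_not_mem hω]
        exact DecisionTree.ind_nonneg _ _
  -- (2) integrate
  have hwt0 : ∀ e : Sym2 (Fin n), 0 ≤ ((w e : unitInterval) : ℝ) := fun e => (w e).2.1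
  have hwt1 : ∀ e : Sym2 (Fin n), ((w e : unitInterval) : ℝ) ≤ 1 := fun e => (w e).2.2
  have hlower : ∑ i, cf i * ∑ σ ∈ (Finset.univ : Finset (Fin m)).powerset,
        W σ * ((prodBernoulli w).real (G σ) - (prodBernoulli w).real (Sp i σ)) ≤
      ∑ σ ∈ (Finset.univ : Finset (Fin m)).powerset, W σ * ((prodBernoulli w).real (D₁ σ) - (prodBernoulli w).real (D₂ σ)) := by
    rw [linkSum_real_sub_eq_sum w W D₁ D₂]
    have hl : ∑ i, cf i * ∑ σ ∈ (Finset.univ : Finset (Fin m)).powerset,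
          W σ * ((prodBernoulli w).real (G σ) - (prodBernoulli w).real (Sp i σ)) =
        ∑ ω : BondConfig (Fin n), BHK2006.weight (fun e => (w e : ℝ)) ω *
          ∑ i, cf i * ∑ σ ∈ (Finset.univ : Finset (Fin m)).powerset, W σ * (DecisionTree.ind (G σ) ω - DecisionTree.ind (Sp i σ) ω) := by
      calc ∑ i, cf i * ∑ σ ∈ (Finset.univ : Finset (Fin m)).powerset,
            W σ * ((prodBernoulli w).real (G σ) - (prodBernoulli w).real (Sp i σ))
          = ∑ i, ∑ ω : BondConfig (Fin n), cf i * (BHK2006.weight (fun e => (w e : ℝ)) ω *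
              ∑ σ ∈ (Finset.univ : Finset (Fin m)).powerset, W σ * (DecisionTree.ind (G σ) ω - DecisionTree.ind (Sp i σ) ω)) := by
            refine Finset.sum_congr rfl fun i _ => ?_
            rw [linkSum_real_sub_eq_sum w W G (Sp i), Finset.mul_sum]
        _ = ∑ ω : BondConfig (Fin n), ∑ i, cf i * (BHK2006.weight (fun e => (w e : ℝ)) ω *
              ∑ σ ∈ (Finset.univ : Finset (Fin m)).powerset, W σ * (DecisionTree.ind (G σ) ω - DecisionTree.ind (Sp i σ) ω)) :=
            Finset.sum_comm
        _ = _ := by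
            refine Finset.sum_congr rfl fun ω _ => ?_
            rw [Finset.mul_sum]
            refine Finset.sum_congr rfl fun i _ => ?_
            ring
    rw [hl]
    exact Finset.sum_le_sum fun ω _ => mul_le_mul_of_nonneg_left (hpt ω) (BHK2006.weight_nonneg hwt0 hwt1 ω)
  -- (3) the lower bound is `Σ_i c_i (I_w(c) − I_w(p i)) ≥ 0`
  have hIc : (prodBernoulli w).real {ω : BondConfig (Fin n) | (A.filter fun z => ω ∈ openConn c z).card ≤ j} =
      ∑ σ ∈ (Finset.univ : Finset (Fin m)).powerset, W σ * (prodBernoulli w).real (G σ) := by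
    have h := lightness_eq_linkSum w A s p p' c j hs hps hp's hpp' hwjunk hsA hcs
    convert h using 12
    exact Iff.rfl
  have hIp : ∀ i, (prodBernoulli w).real {ω : BondConfig (Fin n) | (A.filter fun z => ω ∈ openConn (p i) z).card ≤ j} =
      ∑ σ ∈ (Finset.univ : Finset (Fin m)).powerset, W σ * (prodBernoulli w).real (Sp i σ) := by
    intro i
    have h := lightness_eq_linkSum w A s p p' (p i) j hs hps hp's hpp' hwjunk hsA (fun k => hps i k)
    convert h using 12
    exact Iff.rfl
  have hlb : 0 ≤ ∑ i, cf i * ∑ σ ∈ (Finset.univ : Finset (Fin m)).powerset,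
      W σ * ((prodBernoulli w).real (G σ) - (prodBernoulli w).real (Sp i σ)) := by
    refine Finset.sum_nonneg fun i _ => mul_nonneg (hcf0 i) ?_
    have heq : ∑ σ ∈ (Finset.univ : Finset (Fin m)).powerset, W σ * ((prodBernoulli w).real (G σ) - (prodBernoulli w).real (Sp i σ)) =
        (prodBernoulli w).real {ω : BondConfig (Fin n) | (A.filter fun z => ω ∈ openConn c z).card ≤ j} -
          (prodBernoulli w).real {ω : BondConfig (Fin n) | (A.filter fun z => ω ∈ openConn (p i) z).card ≤ j} := by
      rw [hIc, hIp i, ← Finset.sum_sub_distrib]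
      refine Finset.sum_congr rfl fun σ _ => ?_
      ring
    rw [heq]
    exact sub_nonneg.2 (hdom i)
  exact le_trans hlb hlower

end StarSet

end Summit.CriticalPhenomena.PercolationContinuityZ3.Theorems

end
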